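import Summits.BirchSwinnertonDyer.BirchSwinnertonDyer.Theorems.RamifiedHeegnerPairLeafPartnerOrdersGeneratorsRun
import Summits.BirchSwinnertonDyer.BirchSwinnertonDyer.Theorems.RamifiedHeegnerPairLeafPartnerOrdersBaseChangeDictionary
import Summits.BirchSwinnertonDyer.BirchSwinnertonDyer.Theorems.RamifiedHeegnerPairLeafPartnerOrdersPadicValOfDvd
import HarnessLib

/-!
# Route `RamifiedHeegnerPair`, crux U₁ `LeafRankOneUpperAtThree` (stmt-BirchSwinnertonDyer-26022), line `partnerdescent` —
# partner kernel, base change (α) part 7: THE COORDINATE RUN — from INTEGRAL Brandt-coordinate inputs to `3 ∤ j`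

HONEST FRAMING. Theorems only; helper file (`--supports stmt-BirchSwinnertonDyer-26022 --as helper`); composes ‹…GeneratorsRun› (p812855),
‹…BaseChangeCoordinates› (p813184), ‹…BaseChangeC5›, ‹…BaseChangeOperators›, ‹…BaseChangeLattice›, ‹…BaseChangeDictionary›, ‹…PadicValOfDvd›
(p812067) at `ℤ₃ = ℤ_[3]`; no number theory, no named fact, no `sorry`; nothing booked; BSD is proved for no curve. Lead prover bsd-line-rhp-p2
g64, 2026-08-31.

WHAT. `not_dvd_of_coordinateInputs`: the (α) BASE CHANGE of LEAD-G63-ASSEMBLY.md §4b as ONE theorem whose hypotheses are INTEGRAL and in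
coordinates — a finite index set `ι` (= `Cls O`) with positive weights `w` (Gross's pairing `⟨e_i,e_j⟩ = w_i δ_ij`), the degree-zero lattice
`B` (given by `hB`), a set `G` of pairwise commuting integer matrices preserving `B` (the Hecke generators: Brandt matrices, `U`-operators, …),
an integral twist `W` with right inverse `W′` preserving `B` such that `Xᵀ·(D_w W) = (D_w W)·X` for `X ∈ G` (`W = W′ = 1`: weight symmetry
`w_i X_ij = w_j X_ji`; in general Mazur's Atkin–Lehner twist, which makes the non-self-adjoint `U`-operators admissible), a common eigenvector
`g ∈ Y` of `G` (eigenvalues `λ_X`), an element `U ∈ G` and `κ ∈ ℤ` with `3 ∤ λ_U − κ` and the EXACT-EISENSTEIN property of the twisted pairing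
for `U − κ` (from p806900 `exact_eisenstein` at a good prime `ℓ` with `3 ∤ a_ℓ − ℓ − 1`, via ‹DiagonalDual› p812300), (C3′) MULTIPLICITY ONE in
cosocle form at `𝔪 = (3, X − λ_X : X ∈ G)` with coefficients in `ℤ[G]`, a saturated `G`-stable sublattice `Y ≤ B` (= `X_r(J′)`), (C2′) the
new-projector `u_Y ∈ ℤ[G]` (`u_Y|_Y = N₀ ≠ 0`, `u_Y B ⊆ Y`), the `f`-projector `t ∈ ℤ[G]` (`t B ⊆ ℤ g`) with the dictionary identities
`δ·(t y) = N·Ψ(y)·π^*1` and `Rl·(t y) ∈ N·Y` on `Y` (‹DictionaryArithmetic› p812314), the numerics `δ = Rl·j > 0`, and (C5′)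
«`δ·(C y) = a·Ψ(y)·π^*1` on `Y`, `C ∈ ℤ[G]`, `a ∈ ℤ` ⟹ `δ ∣ a`». CONCLUSION: **`3 ∤ j`**. Proof: read everything over `ℤ₃` (parts 2–6), run
`dvd_of_generatorsRun` (part 1) to get `δ ∣ Rl` in `ℤ₃`, and with `Rl ∣ δ`: `ord₃ δ = ord₃ Rl` (p812067), so `ord₃ j = 0`. What then remains of the
stub (G3♭ᶜ) `CokernelFifthInCoordinatesAtThree` is the INSTANTIATION at a Brandt setup of type `(pM, d)` from the typed print inputs
(D)(C2′)(C3′)(C5′) and the tree theorems (`exact_eisenstein`, `exists_heckeProjector_xi`, `hDictDisc`-shaped data).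
[cite: PapikianRabinoff2016, §3 ¶23–¶25, Lemma 24, Thm. 30, Lemma 32] [cite: Mazur1977, II §15] [cite: Takahashi2001, Thm. 2.3, Thm. 3.2 (a)]
-/

set_option linter.dupNamespace false
set_option autoImplicit false

noncomputable section

open scoped Pointwise

namespace Summit.BirchSwinnertonDyer.BirchSwinnertonDyer.Theorems.LeafPartnerOrders

open Matrix IsLocalRing

/-- **The coordinate run** (see the module docstring): integral Brandt-coordinate inputs ⟹ `3 ∤ j`.
[cite: PapikianRabinoff2016, §3 ¶23–¶25, Lemma 24, Lemma 32] [cite: Mazur1977, II §15] -/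
theorem not_dvd_of_coordinateInputs {ι : Type*} [Fintype ι] [DecidableEq ι]
    (w : ι → ℕ) (hw : ∀ c, 0 < w c)
    (B : Submodule ℤ (ι → ℤ)) (hB : ∀ v : ι → ℤ, v ∈ B ↔ ∑ c, v c = 0)
    (G : Set (Matrix ι ι ℤ)) (hGcomm : ∀ X ∈ G, ∀ X' ∈ G, X * X' = X' * X)
    (hGdeg : ∀ X ∈ G, ∀ v : ι → ℤ, ∑ c, v c = 0 → ∑ c, (X *ᵥ v) c = 0)
    (W W' : Matrix ι ι ℤ) (hWW' : W * W' = 1) (hW'deg : ∀ v : ι → ℤ, ∑ c, v c = 0 → ∑ c, (W' *ᵥ v) c = 0)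
    (hadj : ∀ X ∈ G, Xᵀ * (Matrix.diagonal (fun c ↦ (w c : ℤ)) * W) = (Matrix.diagonal (fun c ↦ (w c : ℤ)) * W) * X)
    (g : ι → ℤ) (hg : g ≠ 0) (lam : Matrix ι ι ℤ → ℤ) (hglam : ∀ X ∈ G, X *ᵥ g = lam X • g)
    (U : Matrix ι ι ℤ) (hU : U ∈ G) (κ : ℤ) (hunit : ¬ (3 : ℤ) ∣ lam U - κ)
    (hEis : ∀ k : ι, ∃ z : ι → ℤ, ∑ c, z c = 0 ∧ ∀ b : ι → ℤ, ∑ c, b c = 0 →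
      z ⬝ᵥ ((Matrix.diagonal (fun c ↦ (w c : ℤ)) * W) *ᵥ b) = (U *ᵥ b) k - κ * b k)
    (x₀ : ι → ℤ) (hx₀ : x₀ ∈ B)
    (hmult : ∀ x ∈ B, ∃ C ∈ Algebra.adjoin ℤ G, x - C *ᵥ x₀ ∈
      (3 : ℤ) • B ⊔ ⨆ X ∈ G, B.map (Matrix.mulVecLin (X - lam X • (1 : Matrix ι ι ℤ))))
    (Y : Submodule ℤ (ι → ℤ)) (hYB : Y ≤ B) (hYsat : ∀ (k : ℤ) (v : ι → ℤ), k ≠ 0 → k • v ∈ Y → v ∈ Y)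
    (hYG : ∀ X ∈ G, ∀ y ∈ Y, X *ᵥ y ∈ Y) (hgY : g ∈ Y)
    (uY : Matrix ι ι ℤ) (huYG : uY ∈ Algebra.adjoin ℤ G) (N₀ : ℤ) (hN₀ : N₀ ≠ 0)
    (huY : ∀ y ∈ Y, uY *ᵥ y = N₀ • y) (huYB : ∀ b ∈ B, uY *ᵥ b ∈ Y)
    (t : Matrix ι ι ℤ) (htG : t ∈ Algebra.adjoin ℤ G) (htline : ∀ x ∈ B, ∃ n : ℤ, t *ᵥ x = n • g)
    (Ψ : (ι → ℤ) →ₗ[ℤ] ℤ) (pb1 : ι → ℤ) (hpb1 : pb1 ∈ B) (N : ℤ) (hN : N ≠ 0)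
    (δ Rl j : ℕ) (hδ : 0 < δ) (hδRl : δ = Rl * j)
    (hP : ∀ y ∈ Y, (δ : ℤ) • (t *ᵥ y) = N • Ψ y • pb1)
    (hlat : ∀ y ∈ Y, ∃ y' ∈ Y, (Rl : ℤ) • (t *ᵥ y) = N • y')
    (hC5 : ∀ C ∈ Algebra.adjoin ℤ G, ∀ a : ℤ, (∀ y ∈ Y, (δ : ℤ) • (C *ᵥ y) = a • Ψ y • pb1) → (δ : ℤ) ∣ a) :
    ¬ 3 ∣ j := by
  classical
  -- 0. numerics: it suffices that `δ ∣ Rl` in `ℤ₃`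
  have hj0 : j ≠ 0 := by rintro rfl; rw [mul_zero] at hδRl; omega
  have hRl0 : Rl ≠ 0 := by rintro rfl; rw [zero_mul] at hδRl; omega
  suffices hdvd : (((δ : ℕ) : ℤ) : ℤ_[3]) ∣ (((Rl : ℕ) : ℤ) : ℤ_[3]) by
    rw [Int.cast_natCast, Int.cast_natCast] at hdvd
    have hval := padicValNat_eq_of_natCast_dvd_of_dvd (p := 3) hδ.ne' hdvd ⟨j, hδRl⟩
    rw [hδRl, padicValNat.mul hRl0 hj0] at hval
    have h0 : padicValNat 3 j = 0 := by omega
    intro h3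
    rcases padicValNat.eq_zero_iff.mp h0 with h | h | h
    · norm_num at h
    · exact hj0 h
    · exact h h3
  -- 1. the degree-zero module `M = B̂ ≤ ℤ₃^ι`
  let cast : (ι → ℤ) → (ι → ℤ_[3]) := fun v c ↦ (v c : ℤ_[3])
  let M : Submodule ℤ_[3] (ι → ℤ_[3]) := LinearMap.ker (∑ c : ι, (LinearMap.proj c : (ι → ℤ_[3]) →ₗ[ℤ_[3]] ℤ_[3]))
  have hM : ∀ v : ι → ℤ_[3], v ∈ M ↔ ∑ c, v c = 0 := fun v ↦ by
    simp only [M, LinearMap.mem_ker, LinearMap.sum_apply, LinearMap.proj_apply]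
  have hcastM : ∀ v : ι → ℤ, ∑ c, v c = 0 → cast v ∈ M := fun v hv ↦ by
    rw [hM]
    have : ((∑ c, v c : ℤ) : ℤ_[3]) = 0 := by rw [hv, Int.cast_zero]
    rwa [Int.cast_sum] at this
  have hBM : ∀ v ∈ B, cast v ∈ M := fun v hv ↦ hcastM v ((hB v).mp hv)
  have htf : ∀ (r : ℤ_[3]) (m : M), r • m = 0 → r = 0 ∨ m = 0 := fun r m h ↦ by
    have h' : r • (m : ι → ℤ_[3]) = 0 := by rw [← Submodule.coe_smul, h, Submodule.coe_zero]
    rcases smul_eq_zero.mp h' with h1 | h1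
    · exact Or.inl h1
    · exact Or.inr (Subtype.ext h1)
  obtain ⟨c₀, hc₀⟩ : ∃ c, g c ≠ 0 := Function.ne_iff.mp hg
  have hgc₀ : (g c₀ : ℤ_[3]) ≠ 0 := by exact_mod_cast hc₀
  let gM : M := ⟨cast g, hBM g (hYB hgY)⟩
  have hgM0 : gM ≠ 0 := fun h ↦ hgc₀ (congrFun (congrArg Subtype.val h) c₀)
  let x₀M : M := ⟨cast x₀, hBM x₀ hx₀⟩
  -- 2. the Hecke generators acting on `M`
  obtain ⟨ρ, hρ⟩ := exists_ringHom_mulVec M hM G hGdeg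
  let gen : G → Module.End ℤ_[3] M := fun X ↦ ρ ⟨X.1, Algebra.subset_adjoin X.2⟩
  let s : Set (Module.End ℤ_[3] M) := Set.range gen
  have hgen : ∀ (X : G) (m : M), ((gen X m : M) : ι → ℤ_[3]) = (X : Matrix ι ι ℤ).map (Int.castRingHom ℤ_[3]) *ᵥ (m : ι → ℤ_[3]) :=
    fun X m ↦ hρ _ m
  have hs' : ∀ f ∈ s, ∃ X ∈ G, ∀ m : M, ((f m : M) : ι → ℤ_[3]) = X.map (Int.castRingHom ℤ_[3]) *ᵥ (m : ι → ℤ_[3]) := by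
    rintro f ⟨X, rfl⟩
    exact ⟨X, X.2, hgen X⟩
  have hGs : ∀ X ∈ G, ∃ f ∈ s, ∀ m : M, ((f m : M) : ι → ℤ_[3]) = X.map (Int.castRingHom ℤ_[3]) *ᵥ (m : ι → ℤ_[3]) :=
    fun X hX ↦ ⟨gen ⟨X, hX⟩, ⟨⟨X, hX⟩, rfl⟩, hgen ⟨X, hX⟩⟩
  have hcomm : ∀ a ∈ s, ∀ b ∈ s, a * b = b * a := by
    rintro _ ⟨X, rfl⟩ _ ⟨X', rfl⟩
    apply LinearMap.ext; intro m; apply Subtype.ext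
    rw [Module.End.mul_apply, Module.End.mul_apply, hgen, hgen, hgen, hgen, mulVec_mulVec, mulVec_mulVec, ← Matrix.map_mul,
      ← Matrix.map_mul, hGcomm X X.2 X' X'.2]
  -- every `C ∈ ℤ[G]` acts through some element of `ℤ₃[s]`
  have hC : ∀ C ∈ Algebra.adjoin ℤ G, ∃ c ∈ Algebra.adjoin ℤ_[3] s,
      ∀ m : M, ((c m : M) : ι → ℤ_[3]) = C.map (Int.castRingHom ℤ_[3]) *ᵥ (m : ι → ℤ_[3]) :=
    fun C hCG ↦ exists_mem_adjoin_acting M G s hGs hCG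
  -- 3. the twisted pairing `β(x, y) = x · (D_w W)^ y`
  let P : Matrix ι ι ℤ := Matrix.diagonal (fun c ↦ (w c : ℤ)) * W
  let Pc : Matrix ι ι ℤ_[3] := P.map (Int.castRingHom ℤ_[3])
  let β : M →ₗ[ℤ_[3]] M →ₗ[ℤ_[3]] ℤ_[3] :=
    LinearMap.mk₂ ℤ_[3] (fun x y ↦ (x : ι → ℤ_[3]) ⬝ᵥ (Pc *ᵥ (y : ι → ℤ_[3])))
      (fun x x' y ↦ by simp only [Submodule.coe_add, add_dotProduct])
      (fun a x y ↦ by simp only [Submodule.coe_smul, smul_dotProduct, smul_eq_mul])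
      (fun x y y' ↦ by simp only [Submodule.coe_add, mulVec_add, dotProduct_add])
      (fun a x y ↦ by simp only [Submodule.coe_smul, mulVec_smul, dotProduct_smul, smul_eq_mul])
  have hβ : ∀ x y : M, β x y = (x : ι → ℤ_[3]) ⬝ᵥ (Pc *ᵥ (y : ι → ℤ_[3])) := fun _ _ ↦ rfl
  have hinv : ∀ f ∈ s, ∀ x y : M, β (f x) y = β x (f y) := by
    rintro _ ⟨X, rfl⟩ x y
    rw [hβ, hβ, hgen, hgen]
    exact dotProduct_map_mulVec_of_transpose_mul (hadj X X.2) _ _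
  have hPW' : P * W' = Matrix.diagonal (fun c ↦ (w c : ℤ)) := by
    rw [Matrix.mul_assoc, hWW', Matrix.mul_one]
  have hdiag : (Matrix.diagonal (fun c ↦ (w c : ℤ))).map (Int.castRingHom ℤ_[3]) = Matrix.diagonal (fun c ↦ (w c : ℤ_[3])) := by
    ext i j
    simp only [Matrix.map_apply, Matrix.diagonal_apply]
    split_ifs <;> simp
  have hnd : ∀ x : M, (∀ y : M, β x y = 0) → x = 0 := by
    intro x hx
    apply Subtype.ext
    refine eq_zero_of_forall_wpair_eq_zero (S := ℤ_[3]) w hw (x : ι → ℤ_[3]) ((hM _).mp x.2) fun z hz ↦ ?_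
    have hz' : W'.map (Int.castRingHom ℤ_[3]) *ᵥ z ∈ M := by
      rw [hM]; exact sum_map_mulVec_eq_zero hW'deg z hz
    have h0 := hx ⟨_, hz'⟩
    rw [hβ] at h0
    change (x : ι → ℤ_[3]) ⬝ᵥ (Pc *ᵥ (W'.map (Int.castRingHom ℤ_[3]) *ᵥ z)) = 0 at h0
    rw [mulVec_mulVec, ← Matrix.map_mul, hPW', hdiag] at h0
    rw [← h0]
    simp only [dotProduct, mulVec_diagonal]
    exact Finset.sum_congr rfl fun c _ ↦ by ring
  -- 4. eigenvalues on `g`, the Eisenstein element `u = Û − κ`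
  let lam' : Module.End ℤ_[3] M → ℤ_[3] := fun f ↦ if h : ∃ c : ℤ_[3], f gM = c • gM then h.choose else 0
  have huniq : ∀ c c' : ℤ_[3], c • gM = c' • gM → c = c' := by
    intro c c' h
    have h1 : c * (g c₀ : ℤ_[3]) = c' * (g c₀ : ℤ_[3]) := by
      have h2 := congrFun (congrArg Subtype.val h) c₀
      simp only [Submodule.coe_smul, Pi.smul_apply, smul_eq_mul] at h2
      exact h2
    exact mul_right_cancel₀ hgc₀ h1
  have hgen_g : ∀ X : G, gen X gM = (lam X : ℤ_[3]) • gM := by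
    intro X
    apply Subtype.ext
    rw [hgen, Submodule.coe_smul]
    change (X : Matrix ι ι ℤ).map (Int.castRingHom ℤ_[3]) *ᵥ cast g = (lam X : ℤ_[3]) • cast g
    rw [show (X : Matrix ι ι ℤ).map (Int.castRingHom ℤ_[3]) *ᵥ cast g = cast (X *ᵥ g) from (map_intCast_mulVec' _ g).symm,
      hglam X X.2]
    exact intCast_vec_smul _ _
  have hlam'gen : ∀ X : G, lam' (gen X) = (lam X : ℤ_[3]) := by
    intro X
    have hex : ∃ c : ℤ_[3], gen X gM = c • gM := ⟨_, hgen_g X⟩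
    have h1 : lam' (gen X) = hex.choose := dif_pos hex
    rw [h1]
    exact huniq _ _ (hex.choose_spec.symm.trans (hgen_g X))
  have hlam : ∀ f ∈ s, f gM = lam' f • gM := by
    rintro _ ⟨X, rfl⟩
    rw [hlam'gen X, hgen_g X]
  have hGs' : ∀ X ∈ G, ∃ f ∈ s, lam' f = (lam X : ℤ_[3]) ∧
      ∀ m : M, ((f m : M) : ι → ℤ_[3]) = X.map (Int.castRingHom ℤ_[3]) *ᵥ (m : ι → ℤ_[3]) :=
    fun X hX ↦ ⟨gen ⟨X, hX⟩, ⟨⟨X, hX⟩, rfl⟩, ⟨hlam'gen ⟨X, hX⟩, hgen ⟨X, hX⟩⟩⟩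
  let u : Module.End ℤ_[3] M := gen ⟨U, hU⟩ - (κ : ℤ_[3]) • (1 : Module.End ℤ_[3] M)
  have hUs : gen ⟨U, hU⟩ ∈ s := ⟨⟨U, hU⟩, rfl⟩
  have hus : u ∈ Algebra.adjoin ℤ_[3] s :=
    Subalgebra.sub_mem _ (Algebra.subset_adjoin hUs) (Subalgebra.smul_mem _ (Subalgebra.one_mem _) _)
  have hu_apply : ∀ y : M, ((u y : M) : ι → ℤ_[3]) = ((gen ⟨U, hU⟩ y : M) : ι → ℤ_[3]) - (κ : ℤ_[3]) • (y : ι → ℤ_[3]) := by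
    intro y
    simp only [u, LinearMap.sub_apply, LinearMap.smul_apply, Module.End.one_apply, Submodule.coe_sub, Submodule.coe_smul]
  let μ : ℤ_[3] := ((lam U - κ : ℤ) : ℤ_[3])
  have huμ : u gM = μ • gM := by
    change gen ⟨U, hU⟩ gM - (κ : ℤ_[3]) • (1 : Module.End ℤ_[3] M) gM = μ • gM
    rw [hgen_g, Module.End.one_apply]
    apply Subtype.ext
    rw [Submodule.coe_sub, Submodule.coe_smul, Submodule.coe_smul, Submodule.coe_smul]
    funext c
    simp only [Pi.sub_apply, Pi.smul_apply, smul_eq_mul, μ, Int.cast_sub]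
    ring
  have hμ : μ ∉ maximalIdeal ℤ_[3] := by
    intro h
    rw [mem_maximalIdeal, PadicInt.mem_nonunits] at h
    have h3 : ((3 : ℕ) : ℤ) ∣ lam U - κ := (PadicInt.norm_int_lt_one_iff_dvd _).mp h
    exact hunit (by exact_mod_cast h3)
  -- 5. exact Eisenstein over `ℤ₃`
  have hEis' : ∀ φ : Module.Dual ℤ_[3] M, ∃ x : M, ∀ y : M, β x y = φ (u y) := by
    obtain ⟨bM, hbM⟩ := exists_basis_coord_eq M hM c₀
    have hx : ∀ k : {c : ι // c ≠ c₀}, ∃ x : M, ∀ y : M, β x y = bM.coord k (u y) := by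
      intro k
      obtain ⟨x, hx⟩ := exists_forall_dotProduct_twist_eq M hM P U κ (gen ⟨U, hU⟩) (hgen ⟨U, hU⟩) hEis k.1
      refine ⟨x, fun y ↦ ?_⟩
      rw [hbM, hβ, hu_apply]
      exact hx y
    choose x hx using hx
    exact forall_exists_pairing_eq_comp_of_basis bM β u x hx
  -- 6. multiplicity one over `ℤ₃`
  have hmult' : ∀ x : M, ∃ c ∈ Algebra.adjoin ℤ_[3] s, x - c x₀M ∈ maximalIdeal ℤ_[3] • (⊤ : Submodule ℤ_[3] M) ⊔
      ⨆ f ∈ s, LinearMap.range (f - lam' f • (1 : Module.End ℤ_[3] M)) :=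
    fun x ↦ exists_sub_mem_of_integral_cosocle M hM B hB G hGdeg s lam lam' hGs' hC x₀ x₀M rfl hmult x
  -- 7. the lattice `Ŷ = ker Ĉ_Y ∩ M`
  obtain ⟨r, CY, hCY⟩ := exists_matrix_mem_iff_mulVec_eq_zero Y hYsat
  let Yh : Submodule ℤ_[3] M := LinearMap.ker ((CY.map (Int.castRingHom ℤ_[3])).mulVecLin ∘ₗ M.subtype)
  have hYh : ∀ m : M, m ∈ Yh ↔ CY.map (Int.castRingHom ℤ_[3]) *ᵥ (m : ι → ℤ_[3]) = 0 := fun m ↦ by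
    simp only [Yh, LinearMap.mem_ker, LinearMap.comp_apply, Submodule.subtype_apply, Matrix.mulVecLin_apply]
  have hcastY : ∀ y ∈ Y, CY.map (Int.castRingHom ℤ_[3]) *ᵥ cast y = 0 := by
    intro y hy
    rw [show CY.map (Int.castRingHom ℤ_[3]) *ᵥ cast y = fun c ↦ (((CY *ᵥ y) c : ℤ) : ℤ_[3]) from (map_intCast_mulVec' CY y).symm,
      (hCY y).mp hy]
    funext c
    simp
  have hYYh : ∀ y ∈ Y, ∃ hy : cast y ∈ M, (⟨cast y, hy⟩ : M) ∈ Yh :=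
    fun y hy ↦ ⟨hBM y (hYB hy), (hYh _).mpr (hcastY y hy)⟩
  have hspanY : ∀ m ∈ Yh, m ∈ Submodule.span ℤ_[3] {m : M | ∃ y ∈ (Y : Set (ι → ℤ)), (m : ι → ℤ_[3]) = cast y} :=
    fun m hm ↦ mem_span_intCast_of_map_mulVec_eq_zero M CY Y hCY (fun y hy ↦ hBM y (hYB hy)) m ((hYh m).mp hm)
  have hsetB : {m : M | ∃ b : ι → ℤ, ∑ c, b c = 0 ∧ (m : ι → ℤ_[3]) = cast b} =
      {m : M | ∃ y ∈ {b : ι → ℤ | ∑ c, b c = 0}, (m : ι → ℤ_[3]) = cast y} := by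
    ext m
    simp only [Set.mem_setOf_eq]
  have hspanM : ∀ m : M, m ∈ Submodule.span ℤ_[3] {m : M | ∃ y ∈ {b : ι → ℤ | ∑ c, b c = 0}, (m : ι → ℤ_[3]) = cast y} := by
    intro m
    rw [← hsetB]
    exact mem_span_intCast_degreeZero M hM c₀ m
  have hYs : ∀ f ∈ s, ∀ m ∈ Yh, f m ∈ Yh := by
    rintro _ ⟨X, rfl⟩ m hm
    rw [hYh]
    exact map_mulVec_eq_zero_of_forall M CY (Y : Set (ι → ℤ)) (gen X) X (hgen X)
      (fun y hy ↦ (hCY _).mp (hYG X X.2 y hy)) m (hspanY m hm)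
  -- the new-projector
  obtain ⟨fY, hfYs, hfY⟩ := hC uY huYG
  have huY' : ∀ m ∈ Yh, fY m = (N₀ : ℤ_[3]) • m := fun m hm ↦
    eq_smul_of_forall_mulVec_eq_smul M (Y : Set (ι → ℤ)) fY uY hfY N₀ huY m (hspanY m hm)
  have huYM : ∀ m : M, fY m ∈ Yh := fun m ↦ (hYh _).mpr
    (map_mulVec_eq_zero_of_forall M CY {b : ι → ℤ | ∑ c, b c = 0} fY uY hfY
      (fun b hb ↦ (hCY _).mp (huYB b ((hB b).mpr hb))) m (hspanM m))
  have hsat' : ∀ m : M, (N₀ : ℤ_[3]) • m ∈ Yh → m ∈ Yh := by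
    intro m hm
    rw [hYh] at hm ⊢
    rw [Submodule.coe_smul, mulVec_smul] at hm
    have hN₀' : (N₀ : ℤ_[3]) ≠ 0 := by exact_mod_cast hN₀
    exact (smul_eq_zero.mp hm).resolve_left hN₀'
  -- 8. the `f`-projector, `P̂`, and the dictionary identities over `ℤ₃`
  obtain ⟨ft, hfts, hft⟩ := hC t htG
  have ht' : ∀ x : M, ∃ a : ℤ_[3], ft x = a • gM := fun x ↦
    exists_eq_smul_of_forall M {b : ι → ℤ | ∑ c, b c = 0} ft t hft g gM rfl (fun b hb ↦ htline b ((hB b).mpr hb)) x (hspanM x)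
  obtain ⟨Ψ', hΨ'⟩ := exists_linearMap_intCast (S := ℤ_[3]) Ψ
  let Pf : M → M := fun m ↦ ⟨Ψ' (m : ι → ℤ_[3]) • cast pb1, M.smul_mem _ (hBM pb1 hpb1)⟩
  have hPf : ∀ m : M, ((Pf m : M) : ι → ℤ_[3]) = Ψ' (m : ι → ℤ_[3]) • cast pb1 := fun _ ↦ rfl
  have hP' : ∀ m ∈ Yh, (((δ : ℕ) : ℤ) : ℤ_[3]) • ft m = (N : ℤ_[3]) • Pf m := fun m hm ↦
    smul_apply_eq_smul_of_forall M (Y : Set (ι → ℤ)) ft t hft Ψ Ψ' hΨ' pb1 Pf hPf (δ : ℤ) N hP m (hspanY m hm)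
  have hlat' : ∀ m ∈ Yh, ∃ m' ∈ Yh, (((Rl : ℕ) : ℤ) : ℤ_[3]) • ft m = (N : ℤ_[3]) • m' := fun m hm ↦
    exists_mem_smul_apply_eq_of_forall M (Y : Set (ι → ℤ)) (Y : Set (ι → ℤ)) ft t hft Yh hYYh (Rl : ℤ) N hlat m (hspanY m hm)
  -- 9. (C5′) over `ℤ₃`
  have hC5' : ∀ a ∈ Algebra.adjoin ℤ_[3] s, ∀ c : ℤ_[3], (∀ m ∈ Yh, (((δ : ℕ) : ℤ) : ℤ_[3]) • a m = c • Pf m) →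
      (((δ : ℕ) : ℤ) : ℤ_[3]) ∣ c :=
    fun a ha c hac ↦ intCast_dvd_of_forall_smul_apply_eq M G s hs' Y Yh hYYh Ψ Ψ' hΨ' pb1 Pf hPf (δ : ℤ) hC5 ha c hac
  -- 10. run
  exact dvd_of_generatorsRun (R := ℤ_[3]) (M := M) htf s hcomm β hinv hnd u hus hEis' hgM0 lam' hlam μ huμ hμ x₀M hmult'
    Yh hYs fY hfYs (N₀ : ℤ_[3]) huY' huYM hsat' ft hfts ht' Pf (N : ℤ_[3]) (((δ : ℕ) : ℤ) : ℤ_[3]) (by exact_mod_cast hN) hP'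
    (((Rl : ℕ) : ℤ) : ℤ_[3]) hlat' hC5'

end Summit.BirchSwinnertonDyer.BirchSwinnertonDyer.Theorems.LeafPartnerOrders

end
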